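import Literature.Combinatorics.Sahi2008.Indicators
import Literature.Combinatorics.Sahi2008.PushForward

/-!
# `NoHeavyLowerTail` (crux stmt-CriticalPhenomena-4575), Sahi programme: **THE THREE-COPY (tensor-Bernstein) FORM OF
# SAHI'S `E₃` ON CUBES** — the coefficient functionals `N_b`, `c_b`, the slice recursion, THREE-COPY HARRIS, and the
# decomposition `c_b = H_b(f;gh) + H_b(g;fh) − [N_b(fg;h;1) − N_b(f;g;h)]`

Support file (Sahi cell, seat `prim-sahi-p1`, generation 53; `--supports stmt-CriticalPhenomena-4575`).  Typed on the census's
request (CENSUS §175 / W197, `comb/w197/ThreeCopySahi.lean`, "a sketch for the typer / p1").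

THE OBJECTS.  Points of the cube `Pt d = Fin d → Bool`; a PROFILE `b : Fin d → ℕ`; the ARRANGEMENTS of profile `b` are the
triples `(x,y,z)` of points with `x_i + y_i + z_i = b_i` for every coordinate (`IsArr b x y z`; empty unless `b ≤ 3`).  For
functions `f g h : Pt d → ℝ` the THREE-COPY FUNCTIONAL is `N_b(f;g;h) = Σ_{(x,y,z) arrangement of b} f(x) g(y) h(z)` (`N3 b f g h`,
trilinear, symmetric under permuting the three copies), and the THREE-COPY SAHI COEFFICIENT is
`c_b(f,g,h) = 2·N_b(fgh;1;1) − N_b(f;gh;1) − N_b(g;fh;1) − N_b(h;fg;1) + N_b(f;g;h)` (`tc b f g h`).  For every product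
("coin") weight `q ∈ [0,1]^d`, Sahi's third functional of [Sahi2008, p. 213] / [LiebSahi2021, (2.1)] is
`E₃^{coin q}(f,g,h) = Σ_{b ∈ {0,…,3}^d} Π_i q_i^{b_i}(1−q_i)^{3−b_i} · c_b(f,g,h)` (three independent copies, grouped by
the coordinatewise sum; companion file `…SahiThreeCopyBernstein`), so the census's conjecture
**3C-SAHI** — `c_b(1_A,1_B,1_C) ≥ 0` for all up-sets `A, B, C` and all profiles `b` (exhaustive for `d ≤ 4`, 1.5·10¹⁰ random
pairs at `d = 5, 6`, 0 negative; CENSUS §175) — would give Sahi's `C₃` for every product measure on every finite cube, hence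
(underlying independents) for every FKG poset.  NOTHING conjectural is asserted in this file.

WHAT IS PROVED HERE (all `d`, all profiles, pure bookkeeping + one induction):
* `N3_cons` — the SLICE RECURSION along coordinate `0`: `N_{(k,b)}(f;g;h) = Σ_{ε₁+ε₂+ε₃ = k} N_b(f^{ε₁}; g^{ε₂}; h^{ε₃})` with the
  sections `f^ε(x) = f(ε, x)`; the four cases `k = 0,1,2,3` spelled out (`N3_cons_zero/one/two/three`).
* **THREE-COPY HARRIS** `N3_le_N3_mul` / `harris3_nonneg`: for nonnegative monotone `f, g` and ANY nonnegative `r`,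
  `N_b(f;g;r) ≤ N_b(fg;1;r)` — the two-function FKG/Harris inequality holds not only for three independent copies but
  arrangement class by arrangement class, with a free spectator in the third copy.  Proof: induction on `d` through `N3_cons`;
  the slice step is `[f¹g¹ + f⁰g⁰ − f¹g⁰ − f⁰g¹] = (f¹−f⁰)(g¹−g⁰) ≥ 0` pointwise (sections of a monotone function are monotone
  and nested).  [this work; the census proved the spectator-free two-copy case by Harris–Kleitman twice, README-W197 "WHY"]
* `tc_eq_harris_sub` — `c_b(f,g,h) = [N_b(fgh;1;1) − N_b(f;gh;1)] + [N_b(fgh;1;1) − N_b(g;fh;1)] − [N_b(fg;h;1) − N_b(f;g;h)]`: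
  3C-SAHI says that the spectator-`h` Harris gap of `(f,g)` is at most the sum of the Harris gaps of `(f, gh)` and `(g, fh)`;
  consequence `tc_one_right` (`c_b(f,g,1) = N_b(fg;1;1) − N_b(f;g;1) ≥ 0`: the coefficientwise form of `E₃(f,g,1) = Cov(f,g)`).
* `ThreeCopySahi` — the census's conjecture 3C-SAHI as an OBLIGATION (`@[conjecture] def`, functions form: `0 ≤ c_b(f,g,h)` for
  all `d`, all profiles and all nonnegative monotone `f, g, h` on `{0,1}^d`; for indicators of up-sets this is CENSUS §175 verbatim,
  and the two forms are equivalent by trilinearity and the finite layer cake).  OPEN; never a hypothesis-free fact here.  The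
  companion file proves `ThreeCopySahi → SahiConjecture 3` (all FKG posets) `→ KahnConjecture`.
Nothing here is specific to indicators; the functionals are stated for real functions (trilinear), the inequalities for
nonnegative monotone ones.  [this work; objects: CENSUS §175 W197 (prim-sahi-census gen 54)]
-/

namespace Summit.CriticalPhenomena.PercolationContinuityZ3.Theorems.SahiThreeCopy

open Finset Function Literature.Combinatorics.Sahi2008
open scoped BigOperators

noncomputable section

/-! ### §1 Points, arrangements, the three-copy functionals -/

/-- Points of the `d`-cube. [this work; CENSUS §175 W197] -/
abbrev Pt (d : ℕ) := Fin d → Bool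

variable {d : ℕ}

/-- `(x,y,z)` is an ARRANGEMENT of the profile `b`: `x_i + y_i + z_i = b_i` at every coordinate (as naturals, `Bool.toNat`).
[this work; CENSUS §175 W197] -/
def IsArr (b : Fin d → ℕ) (x y z : Pt d) : Prop := ∀ i, (x i).toNat + (y i).toNat + (z i).toNat = b i

/-- `IsArr` is decidable (a finite conjunction of equalities of naturals). [this work] -/
instance instDecidableIsArr (b : Fin d → ℕ) (x y z : Pt d) : Decidable (IsArr b x y z) := by
  unfold IsArr; infer_instance

/-- The THREE-COPY FUNCTIONAL `N_b(f;g;h) = Σ_{(x,y,z) arrangement of b} f(x)·g(y)·h(z)`. [this work; CENSUS §175 W197] -/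
def N3 (b : Fin d → ℕ) (f g h : Pt d → ℝ) : ℝ :=
  ∑ x : Pt d, ∑ y : Pt d, ∑ z : Pt d, if IsArr b x y z then f x * g y * h z else 0

/-- The THREE-COPY SAHI COEFFICIENT `c_b(f,g,h) = 2N_b(fgh;1;1) − N_b(f;gh;1) − N_b(g;fh;1) − N_b(h;fg;1) + N_b(f;g;h)`
(the tensor-Bernstein coefficient of Sahi's `E₃` in multidegree `(3,…,3)`, companion file). [this work; CENSUS §175 W197] -/
def tc (b : Fin d → ℕ) (f g h : Pt d → ℝ) : ℝ :=
  2 * N3 b (f * g * h) 1 1 - (N3 b f (g * h) 1 + N3 b g (f * h) 1 + N3 b h (f * g) 1) + N3 b f g h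

/-- The section `f^ε(x) = f(ε, x)` of a function on the `(d+1)`-cube along coordinate `0`. [this work] -/
def sec (f : Pt (d + 1) → ℝ) (ε : Bool) : Pt d → ℝ := fun x => f (Fin.cons ε x)

/-! ### §2 Elementary properties -/

/-- Symmetry of `N_b` in the first two copies. [this work] -/
theorem N3_comm12 (b : Fin d → ℕ) (f g h : Pt d → ℝ) : N3 b f g h = N3 b g f h := by
  unfold N3
  rw [sum_comm]
  refine sum_congr rfl fun y _ => sum_congr rfl fun x _ => sum_congr rfl fun z _ => ?_
  have : IsArr b x y z ↔ IsArr b y x z := by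
    unfold IsArr; exact forall_congr' fun i => by constructor <;> intro h <;> omega
  simp only [this]
  split_ifs <;> ring

/-- Symmetry of `N_b` in the last two copies. [this work] -/
theorem N3_comm23 (b : Fin d → ℕ) (f g h : Pt d → ℝ) : N3 b f g h = N3 b f h g := by
  unfold N3
  refine sum_congr rfl fun x _ => ?_
  rw [sum_comm]
  refine sum_congr rfl fun z _ => sum_congr rfl fun y _ => ?_
  have : IsArr b x y z ↔ IsArr b x z y := by
    unfold IsArr; exact forall_congr' fun i => by constructor <;> intro h <;> omega
  simp only [this]
  split_ifs <;> ring

/-- Symmetry of `N_b` in the first and last copies. [this work] -/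
theorem N3_comm13 (b : Fin d → ℕ) (f g h : Pt d → ℝ) : N3 b f g h = N3 b h g f := by
  rw [N3_comm12, N3_comm23, N3_comm12]

/-- `N_b` is additive in the first copy. [this work] -/
theorem N3_add_left (b : Fin d → ℕ) (f f' g h : Pt d → ℝ) : N3 b (f + f') g h = N3 b f g h + N3 b f' g h := by
  unfold N3
  simp only [← sum_add_distrib]
  refine sum_congr rfl fun x _ => sum_congr rfl fun y _ => sum_congr rfl fun z _ => ?_
  split_ifs <;> simp [add_mul]

/-- `N_b` is subtractive in the first copy. [this work] -/
theorem N3_sub_left (b : Fin d → ℕ) (f f' g h : Pt d → ℝ) : N3 b (f - f') g h = N3 b f g h - N3 b f' g h := by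
  have := N3_add_left b (f - f') f' g h
  rw [sub_add_cancel] at this
  linarith

/-- `N_b` is homogeneous in the first copy. [this work] -/
theorem N3_smul_left (b : Fin d → ℕ) (c : ℝ) (f g h : Pt d → ℝ) : N3 b (c • f) g h = c * N3 b f g h := by
  unfold N3
  simp only [mul_sum]
  refine sum_congr rfl fun x _ => sum_congr rfl fun y _ => sum_congr rfl fun z _ => ?_
  split_ifs <;> simp [mul_assoc]

/-- `N_b ≥ 0` on nonnegative functions. [this work] -/
theorem N3_nonneg (b : Fin d → ℕ) {f g h : Pt d → ℝ} (hf : ∀ x, 0 ≤ f x) (hg : ∀ x, 0 ≤ g x) (hh : ∀ x, 0 ≤ h x) :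
    0 ≤ N3 b f g h := by
  unfold N3
  refine sum_nonneg fun x _ => sum_nonneg fun y _ => sum_nonneg fun z _ => ?_
  split_ifs
  · exact mul_nonneg (mul_nonneg (hf x) (hg y)) (hh z)
  · exact le_rfl

/-- `N_b` is monotone in the first copy for nonnegative spectators. [this work] -/
theorem N3_mono_left (b : Fin d → ℕ) {f f' g h : Pt d → ℝ} (hff' : ∀ x, f x ≤ f' x) (hg : ∀ x, 0 ≤ g x)
    (hh : ∀ x, 0 ≤ h x) : N3 b f g h ≤ N3 b f' g h := by
  have h1 : N3 b f' g h = N3 b f g h + N3 b (f' - f) g h := by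
    rw [← N3_add_left]; congr 1; abel
  rw [h1]
  have := N3_nonneg b (f := f' - f) (fun x => sub_nonneg.2 (hff' x)) hg hh
  linarith

/-- `c_b` is symmetric in its first two arguments. [this work] -/
theorem tc_comm12 (b : Fin d → ℕ) (f g h : Pt d → ℝ) : tc b f g h = tc b g f h := by
  unfold tc
  rw [mul_comm f g, N3_comm12 b f g h, mul_comm g h, mul_comm f h]
  ring

/-- `c_b` is symmetric in its last two arguments. [this work] -/
theorem tc_comm23 (b : Fin d → ℕ) (f g h : Pt d → ℝ) : tc b f g h = tc b f h g := by
  unfold tc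
  rw [N3_comm23 b f g h, mul_right_comm f g h, mul_comm g h, mul_comm f h, mul_comm f g]
  ring

/-! ### §3 The slice recursion along coordinate `0` -/

/-- Splitting a sum over the `(d+1)`-cube along coordinate `0`. [folklore] -/
theorem sum_pt_succ (F : Pt (d + 1) → ℝ) : ∑ x, F x = ∑ ε : Bool, ∑ x' : Pt d, F (Fin.cons ε x') := by
  rw [← Fintype.sum_equiv (Fin.consEquiv fun _ : Fin (d + 1) => Bool) (fun p => F (Fin.cons p.1 p.2)) F
    (fun p => rfl), Fintype.sum_prod_type]

/-- The arrangement condition splits along coordinate `0`. [this work] -/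
theorem isArr_cons_iff (k : ℕ) (b : Fin d → ℕ) (ε₁ ε₂ ε₃ : Bool) (x y z : Pt d) :
    IsArr (Fin.cons k b : Fin (d + 1) → ℕ) (Fin.cons ε₁ x) (Fin.cons ε₂ y) (Fin.cons ε₃ z) ↔
      (ε₁.toNat + ε₂.toNat + ε₃.toNat = k ∧ IsArr b x y z) := by
  unfold IsArr
  rw [Fin.forall_fin_succ]
  simp only [Fin.cons_zero, Fin.cons_succ]

/-- `isArr_cons_iff` inside an `if`. [this work] -/
theorem ite_isArr_cons (k : ℕ) (b : Fin d → ℕ) (ε₁ ε₂ ε₃ : Bool) (x y z : Pt d) (a c : ℝ) :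
    (if IsArr (Fin.cons k b : Fin (d + 1) → ℕ) (Fin.cons ε₁ x) (Fin.cons ε₂ y) (Fin.cons ε₃ z) then a else c) =
      if (ε₁.toNat + ε₂.toNat + ε₃.toNat = k ∧ IsArr b x y z) then a else c :=
  if_congr (isArr_cons_iff k b ε₁ ε₂ ε₃ x y z) rfl rfl

/-- Reordering a sixfold sum (plumbing). [folklore] -/
theorem sum6_comm (S : Bool → Pt d → Bool → Pt d → Bool → Pt d → ℝ) :
    ∑ ε₁ : Bool, ∑ x : Pt d, ∑ ε₂ : Bool, ∑ y : Pt d, ∑ ε₃ : Bool, ∑ z : Pt d, S ε₁ x ε₂ y ε₃ z =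
      ∑ ε₁ : Bool, ∑ ε₂ : Bool, ∑ ε₃ : Bool, ∑ x : Pt d, ∑ y : Pt d, ∑ z : Pt d, S ε₁ x ε₂ y ε₃ z := by
  refine sum_congr rfl fun ε₁ _ => ?_
  rw [sum_comm]
  refine sum_congr rfl fun ε₂ _ => ?_
  calc (∑ x : Pt d, ∑ y : Pt d, ∑ ε₃ : Bool, ∑ z : Pt d, S ε₁ x ε₂ y ε₃ z)
      = ∑ x : Pt d, ∑ ε₃ : Bool, ∑ y : Pt d, ∑ z : Pt d, S ε₁ x ε₂ y ε₃ z :=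
        sum_congr rfl fun x _ => sum_comm
    _ = ∑ ε₃ : Bool, ∑ x : Pt d, ∑ y : Pt d, ∑ z : Pt d, S ε₁ x ε₂ y ε₃ z := sum_comm

/-- **Slice recursion**: `N_{(k,b)}(f;g;h) = Σ_{ε₁+ε₂+ε₃ = k} N_b(f^{ε₁}; g^{ε₂}; h^{ε₃})`. [this work] -/
theorem N3_cons (k : ℕ) (b : Fin d → ℕ) (f g h : Pt (d + 1) → ℝ) :
    N3 (Fin.cons k b : Fin (d + 1) → ℕ) f g h =
      ∑ ε₁ : Bool, ∑ ε₂ : Bool, ∑ ε₃ : Bool,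
        if ε₁.toNat + ε₂.toNat + ε₃.toNat = k then N3 b (sec f ε₁) (sec g ε₂) (sec h ε₃) else 0 := by
  unfold N3 sec
  simp only [sum_pt_succ, ite_isArr_cons]
  refine (sum6_comm _).trans ?_
  refine sum_congr rfl fun ε₁ _ => sum_congr rfl fun ε₂ _ => sum_congr rfl fun ε₃ _ => ?_
  by_cases hc : ε₁.toNat + ε₂.toNat + ε₃.toNat = k
  · simp only [hc, true_and, if_true]
  · simp only [hc, false_and, if_false, sum_const_zero]

/-- Slice `k = 0`: all three copies see the bottom section. [this work] -/
theorem N3_cons_zero (b : Fin d → ℕ) (f g h : Pt (d + 1) → ℝ) :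
    N3 (Fin.cons 0 b : Fin (d + 1) → ℕ) f g h = N3 b (sec f false) (sec g false) (sec h false) := by
  rw [N3_cons]
  simp only [Fintype.sum_bool, Bool.toNat_true, Bool.toNat_false]
  norm_num

/-- Slice `k = 1`: exactly one copy sees the top section. [this work] -/
theorem N3_cons_one (b : Fin d → ℕ) (f g h : Pt (d + 1) → ℝ) :
    N3 (Fin.cons 1 b : Fin (d + 1) → ℕ) f g h =
      N3 b (sec f true) (sec g false) (sec h false) + N3 b (sec f false) (sec g true) (sec h false) +
        N3 b (sec f false) (sec g false) (sec h true) := by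
  rw [N3_cons]
  simp only [Fintype.sum_bool, Bool.toNat_true, Bool.toNat_false]
  norm_num
  ring

/-- Slice `k = 2`: exactly one copy sees the bottom section. [this work] -/
theorem N3_cons_two (b : Fin d → ℕ) (f g h : Pt (d + 1) → ℝ) :
    N3 (Fin.cons 2 b : Fin (d + 1) → ℕ) f g h =
      N3 b (sec f false) (sec g true) (sec h true) + N3 b (sec f true) (sec g false) (sec h true) +
        N3 b (sec f true) (sec g true) (sec h false) := by
  rw [N3_cons]
  simp only [Fintype.sum_bool, Bool.toNat_true, Bool.toNat_false]
  norm_num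
  ring

/-- Slice `k = 3`: all three copies see the top section. [this work] -/
theorem N3_cons_three (b : Fin d → ℕ) (f g h : Pt (d + 1) → ℝ) :
    N3 (Fin.cons 3 b : Fin (d + 1) → ℕ) f g h = N3 b (sec f true) (sec g true) (sec h true) := by
  rw [N3_cons]
  simp only [Fintype.sum_bool, Bool.toNat_true, Bool.toNat_false]
  norm_num

/-- Slices `k ≥ 4` are empty. [this work] -/
theorem N3_cons_add_four (k : ℕ) (b : Fin d → ℕ) (f g h : Pt (d + 1) → ℝ) :
    N3 (Fin.cons (k + 4) b : Fin (d + 1) → ℕ) f g h = 0 := by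
  rw [N3_cons]
  refine sum_eq_zero fun ε₁ _ => sum_eq_zero fun ε₂ _ => sum_eq_zero fun ε₃ _ => ?_
  have : ε₁.toNat + ε₂.toNat + ε₃.toNat ≠ k + 4 := by
    have h1 := Bool.toNat_le ε₁; have h2 := Bool.toNat_le ε₂; have h3 := Bool.toNat_le ε₃; omega
  rw [if_neg this]

/-- In dimension `0` the cube is a point and every profile has exactly one arrangement. [this work] -/
theorem N3_dim_zero (b : Fin 0 → ℕ) (f g h : Pt 0 → ℝ) :
    N3 b f g h = f (fun i => Fin.elim0 i) * g (fun i => Fin.elim0 i) * h (fun i => Fin.elim0 i) := by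
  have key : ∀ x y z : Pt 0, (if IsArr b x y z then f x * g y * h z else 0) =
      f (fun i => Fin.elim0 i) * g (fun i => Fin.elim0 i) * h (fun i => Fin.elim0 i) := by
    intro x y z
    have hx : x = fun i => Fin.elim0 i := Subsingleton.elim _ _
    have hy : y = fun i => Fin.elim0 i := Subsingleton.elim _ _
    have hz : z = fun i => Fin.elim0 i := Subsingleton.elim _ _
    subst hx hy hz
    exact if_pos (fun i => Fin.elim0 i)
  unfold N3
  rw [Fintype.sum_unique, Fintype.sum_unique, Fintype.sum_unique]
  exact key _ _ _

/-! ### §4 Sections of nonnegative monotone functions -/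

/-- Sections of a nonnegative function are nonnegative. [this work] -/
theorem sec_nonneg {f : Pt (d + 1) → ℝ} (hf : ∀ x, 0 ≤ f x) (ε : Bool) : ∀ x, 0 ≤ sec f ε x := fun _ => hf _

/-- Sections of a monotone function are monotone. [this work] -/
theorem sec_monotone {f : Pt (d + 1) → ℝ} (hf : Monotone f) (ε : Bool) : Monotone (sec f ε) :=
  fun _ _ hxy => hf (Fin.cons_le_cons.2 ⟨le_rfl, hxy⟩)

/-- The sections of a monotone function are nested: `f⁰ ≤ f¹`. [this work] -/
theorem sec_false_le_sec_true {f : Pt (d + 1) → ℝ} (hf : Monotone f) (x : Pt d) : sec f false x ≤ sec f true x :=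
  hf (Fin.cons_le_cons.2 ⟨Bool.false_le _, le_rfl⟩)

/-- Sections of a product. [this work] -/
theorem sec_mul (f g : Pt (d + 1) → ℝ) (ε : Bool) : sec (f * g) ε = sec f ε * sec g ε := rfl

/-- Sections of the constant `1`. [this work] -/
theorem sec_one (ε : Bool) : sec (1 : Pt (d + 1) → ℝ) ε = 1 := rfl

/-! ### §5 Three-copy Harris -/

/-- The mixed-difference identity in the first copy:
`N_b((f₁−f₀)(g₁−g₀); u; r) = N_b(f₁g₁;u;r) − N_b(f₁g₀;u;r) − N_b(f₀g₁;u;r) + N_b(f₀g₀;u;r)`. [this work] -/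
theorem N3_sub_mul_sub (b : Fin d → ℕ) (f₁ f₀ g₁ g₀ u r : Pt d → ℝ) :
    N3 b ((f₁ - f₀) * (g₁ - g₀)) u r = N3 b (f₁ * g₁) u r - N3 b (f₁ * g₀) u r - N3 b (f₀ * g₁) u r + N3 b (f₀ * g₀) u r := by
  have : (f₁ - f₀) * (g₁ - g₀) = f₁ * g₁ - f₁ * g₀ - (f₀ * g₁ - f₀ * g₀) := by ring
  rw [this, N3_sub_left, N3_sub_left, N3_sub_left]
  ring

/-- The slice step of three-copy Harris: for nested `f₀ ≤ f₁`, `g₀ ≤ g₁` and nonnegative spectators,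
`N_b(f₁g₀;u;r) + N_b(f₀g₁;u;r) ≤ N_b(f₁g₁;u;r) + N_b(f₀g₀;u;r)`. [this work] -/
theorem N3_cross_le (b : Fin d → ℕ) {f₁ f₀ g₁ g₀ u r : Pt d → ℝ} (hf : ∀ x, f₀ x ≤ f₁ x) (hg : ∀ x, g₀ x ≤ g₁ x)
    (hu : ∀ x, 0 ≤ u x) (hr : ∀ x, 0 ≤ r x) :
    N3 b (f₁ * g₀) u r + N3 b (f₀ * g₁) u r ≤ N3 b (f₁ * g₁) u r + N3 b (f₀ * g₀) u r := by
  have h := N3_nonneg b (f := (f₁ - f₀) * (g₁ - g₀)) (g := u) (h := r)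
    (fun x => mul_nonneg (sub_nonneg.2 (hf x)) (sub_nonneg.2 (hg x))) hu hr
  rw [N3_sub_mul_sub] at h
  linarith

/-- **Three-copy Harris.**  For nonnegative monotone `f, g : {0,1}^d → ℝ`, any nonnegative `r` and every profile `b`:
`N_b(f;g;r) ≤ N_b(fg;1;r)` — arrangement class by arrangement class, the positively correlated pair `(f,g)` put on one
copy beats the pair split over two (disjointly supported) copies, whatever the third copy does.  Summed against
`Π q_i^{b_i}(1−q_i)^{3−b_i}` this is Harris's inequality `E(f)E(g) ≤ E(fg)` for the product measure (with an idle third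
copy); here it holds coefficientwise.  Proof: induction on `d` by the slice recursion. [this work; two-copy case without
spectator: CENSUS §175 W197 (Harris–Kleitman twice)] -/
theorem N3_le_N3_mul : ∀ (d : ℕ) (b : Fin d → ℕ) (f g r : Pt d → ℝ), (∀ x, 0 ≤ f x) → Monotone f →
    (∀ x, 0 ≤ g x) → Monotone g → (∀ x, 0 ≤ r x) → N3 b f g r ≤ N3 b (f * g) 1 r := by
  intro d
  induction d with
  | zero =>
    intro b f g r _ _ _ _ _
    rw [N3_dim_zero, N3_dim_zero]
    simp
  | succ d ih =>
    intro b f g r hf hfm hg hgm hr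
    have hb : b = Fin.cons (b 0) (Fin.tail b) := (Fin.cons_self_tail b).symm
    set b' := Fin.tail b
    -- sections and their properties
    have sf := sec_nonneg hf; have sg := sec_nonneg hg; have sr := sec_nonneg hr
    have mf := sec_monotone hfm; have mg := sec_monotone hgm
    have nf := sec_false_le_sec_true hfm; have ng := sec_false_le_sec_true hgm
    have IH : ∀ (ε₁ ε₂ ε₃ : Bool), N3 b' (sec f ε₁) (sec g ε₂) (sec r ε₃) ≤
        N3 b' (sec f ε₁ * sec g ε₂) 1 (sec r ε₃) :=
      fun ε₁ ε₂ ε₃ => ih b' _ _ _ (sf ε₁) (mf ε₁) (sg ε₂) (mg ε₂) (sr ε₃)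
    have one_nn : ∀ x : Pt d, (0 : ℝ) ≤ (1 : Pt d → ℝ) x := fun _ => zero_le_one
    rw [hb]
    match hk : b 0 with
    | 0 =>
      rw [N3_cons_zero, N3_cons_zero, sec_mul, sec_one]
      exact IH false false false
    | 1 =>
      rw [N3_cons_one, N3_cons_one, sec_mul, sec_mul, sec_one, sec_one]
      have h1 := IH true false false; have h2 := IH false true false; have h3 := IH false false true
      have hx := N3_cross_le b' (u := 1) nf ng one_nn (sr false)
      linarith
    | 2 =>
      rw [N3_cons_two, N3_cons_two, sec_mul, sec_mul, sec_one, sec_one]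
      have h1 := IH false true true; have h2 := IH true false true; have h3 := IH true true false
      have hx := N3_cross_le b' (u := 1) nf ng one_nn (sr true)
      linarith
    | 3 =>
      rw [N3_cons_three, N3_cons_three, sec_mul, sec_one]
      exact IH true true true
    | k + 4 =>
      rw [N3_cons_add_four, N3_cons_add_four]

/-- Three-copy Harris, named form with the Harris gap `H_b(f,g;r) := N_b(fg;1;r) − N_b(f;g;r) ≥ 0`. [this work] -/
theorem harris3_nonneg (b : Fin d → ℕ) {f g r : Pt d → ℝ} (hf : ∀ x, 0 ≤ f x) (hfm : Monotone f)
    (hg : ∀ x, 0 ≤ g x) (hgm : Monotone g) (hr : ∀ x, 0 ≤ r x) : 0 ≤ N3 b (f * g) 1 r - N3 b f g r :=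
  sub_nonneg.2 (N3_le_N3_mul d b f g r hf hfm hg hgm hr)

/-! ### §6 The Harris decomposition of the three-copy Sahi coefficient -/

/-- **`c_b = H_b(f;gh) + H_b(g;fh) − H_b(f,g | h)`**:
`c_b(f,g,h) = [N_b(fgh;1;1) − N_b(f;gh;1)] + [N_b(fgh;1;1) − N_b(g;fh;1)] − [N_b(fg;h;1) − N_b(f;g;h)]` — the coefficientwise
form of `E₃ = Cov(f,gh) + Cov(g,fh) − E[h]·Cov(f,g)`-type rearrangements; all three brackets are three-copy Harris gaps
(nonnegative for nonnegative monotone data). [this work] -/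
theorem tc_eq_harris_sub (b : Fin d → ℕ) (f g h : Pt d → ℝ) :
    tc b f g h = (N3 b (f * g * h) 1 1 - N3 b f (g * h) 1) + (N3 b (f * g * h) 1 1 - N3 b g (f * h) 1) -
      (N3 b (f * g) h 1 - N3 b f g h) := by
  unfold tc
  rw [N3_comm12 b h (f * g) 1]
  ring

/-- With a constant slot the three-copy Sahi coefficient IS a Harris gap: `c_b(f,g,1) = N_b(fg;1;1) − N_b(f;g;1)` — the
coefficientwise form of `E₃(f,g,1) = E₂(f,g) = Cov(f,g)` [Sahi2008, Thm. 6]. [this work] -/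
theorem tc_one_right (b : Fin d → ℕ) (f g : Pt d → ℝ) : tc b f g 1 = N3 b (f * g) 1 1 - N3 b f g 1 := by
  unfold tc
  rw [mul_one, mul_one, mul_one, N3_comm12 b 1 (f * g) 1, N3_comm12 b g f 1]
  ring

/-- Hence `c_b(f,g,1) ≥ 0` for nonnegative monotone `f, g` (coefficientwise Harris in three-copy form). [this work] -/
theorem tc_one_right_nonneg (b : Fin d → ℕ) {f g : Pt d → ℝ} (hf : ∀ x, 0 ≤ f x) (hfm : Monotone f)
    (hg : ∀ x, 0 ≤ g x) (hgm : Monotone g) : 0 ≤ tc b f g 1 := by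
  rw [tc_one_right]
  exact harris3_nonneg b hf hfm hg hgm fun _ => zero_le_one

/-! ### §7 The obligation 3C-SAHI (census conjecture; OPEN) -/

/-- **3C-SAHI** (CENSUS §175 / W197, prim-sahi-census gen 54), functions form: for every dimension `d`, every profile `b`
and all pointwise nonnegative monotone `f, g, h : {0,1}^d → ℝ`, the three-copy Sahi coefficient is nonnegative,
`0 ≤ c_b(f,g,h)` — "Sahi's `E₃` is Bernstein-positive in the minimal tensor multidegree `(3,…,3)` on every finite cube".
For indicators of up-sets this is the census's statement verbatim (the forms are equivalent by trilinearity of `c_b` and the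
finite layer cake); evidence: exhaustive for `d ≤ 4` (1.2·10⁹ (triple, profile) pairs), 1.5·10¹⁰ random pairs at `d = 5, 6`,
0 negative.  It implies Sahi's `C₃` for every FKG poset (companion file `…SahiThreeCopyBernstein`:
`ThreeCopySahi → SahiConjecture 3`).  OPEN — an obligation / hypothesis, never a fact; a proof would be `ThreeCopySahi_holds`.
[this work; CENSUS §175 W197] [status: open] -/
@[conjecture] def ThreeCopySahi : Prop :=
  ∀ (d : ℕ) (b : Fin d → ℕ) (f g h : Pt d → ℝ), (∀ x, 0 ≤ f x) → (∀ x, 0 ≤ g x) → (∀ x, 0 ≤ h x) →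
    Monotone f → Monotone g → Monotone h → 0 ≤ tc b f g h

/-- The slot `h = 1` of 3C-SAHI is a THEOREM (three-copy Harris): `0 ≤ c_b(f,g,1)`. [this work] -/
theorem threeCopySahi_one_right (d : ℕ) (b : Fin d → ℕ) (f g : Pt d → ℝ) (hf : ∀ x, 0 ≤ f x) (hg : ∀ x, 0 ≤ g x)
    (hfm : Monotone f) (hgm : Monotone g) : 0 ≤ tc b f g 1 :=
  tc_one_right_nonneg b hf hfm hg hgm

end

end Summit.CriticalPhenomena.PercolationContinuityZ3.Theorems.SahiThreeCopy
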